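import Literature.Probability.LatticeModels.SahiThirdOrderCorrelation
import HarnessLib

/-!
# `NoHeavyLowerTail` (stmt-CriticalPhenomena-4575) — the Δ-sharpening of Sahi's `E₃` (conjecture R1):
# pair form, slot relations, and the proved corners `U = Ω`, `W = Ω`, `U ⊇ V ∪ W`, diagonal

Support file (new-inequality factory seat `prim-ineq-gen-4`, gen 7; `--supports stmt-CriticalPhenomena-4575`).  No definitions,
no named facts, no sorries: `ring` identities over a commutative ring and their measure-level consequences (Harris as a
hypothesis; discharged for product measures `prodBernoulli p` by `prodBernoulli_harris`).  Companion of the memos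
run/shared/lean/prim/prim-ineq-gen-4/CONJECTURE-R1-R4.md, FINDING-NOGO-INSTANCE-BLIND-g6.md §6–§8 and
FINDING-PAIR-FORM-AND-TRANSPORT-g7.md §1, §4, and of `…SahiE3UnionContainment` (p199320), `…SahiE3TwoLevel` (p195570's companion).

SETTING.  For three events `U, V, W` under a probability measure write `m_S` for the measure of `⋂_{f∈S} f`; Sahi's
`E₃ = 2m_uvw − (m_u m_vw + m_v m_uw + m_w m_uv) + m_u m_v m_w` (tree: `Literature.Probability.LatticeModels.sahiE3`).  The seat's
census-clean CONJECTURE R1 (m ≤ 5 exhaustive at the fibre level, 1.37·10¹¹ cells; FKG Ising cube 2.9·10⁹ cells; graph dictionaries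
7·10⁹ cells) sharpens Kahn's Conjecture 5 (`E₃ ≥ 0` for increasing events of a product measure) to the TWO-SIDED `E₃ ≥ |Δ_U|` with
  `Δ_U := m_uvw·[(m_uv + m_u m_v) + (m_uw + m_u m_w) − (m_vw + m_v m_w)] + m_vw·[m_uv(m_w − m_u) + m_uw(m_v − m_u)] − m_uv m_uw (m_v + m_w)`.
This file records, kernel-checked:
* `deltaU_eq_pair_form` — the PAIR FORM `Δ_U = Π_{UV} + Π_{UW} − Π_{VW}` with the pair functional
  `Π_{VW} := m_uvw(m_vw + m_v m_w) − m_vw(m_v m_uw + m_w m_uv)` (linear in the `U`-slot), and `two_piVW_eq` : `2Π_{VW} = Δ_V + Δ_W`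
  (so `span{Δ_U,Δ_V,Δ_W} = span{Π_UV,Π_UW,Π_VW}`; R1 ⟹ `E₃ ≥ |Π_{VW}|`);
* the corners where R1 is a theorem, as factorisations: `U = Ω`: `E₃ − Δ_U = Cov(V,W)·μ(Vᶜ∩Wᶜ)`, `E₃ + Δ_U = Cov(V,W)(1 + μ(V∪W))`;
  `W = Ω`: `E₃ ∓ Δ_U = Cov(U,V)·(1 ∓ (m_u + m_uv − m_v))`; `U ⊇ V ∪ W`: `E₃ − Δ_U = Cov(V,W)(2 − m_u − μ(V∪W))`,
  `E₃ + Δ_U = Cov(V,W)(2 − m_u + μ(V∪W))`; diagonal `U = V = W`: `E₃ − Δ = 2f(1−f)²`, `E₃ + Δ = 2f(1−f)`;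
* the measure-level statements: for ANY measure and events with `V, W` positively correlated, `|Δ_U(Ω,V,W)| ≤ E₃(Ω,V,W)`
  (`abs_deltaU_le_sahiE3_univ`), and for `prodBernoulli p` and increasing `V, W` (`prodBernoulli_abs_deltaU_le_sahiE3_univ`);
  similarly `U ⊇ V ∪ W` (`abs_deltaU_le_sahiE3_of_subset_subset`, `prodBernoulli_abs_deltaU_le_sahiE3_of_union_subset`).
The general case `E₃ ≥ |Δ_U|` is OPEN (it contains Kahn's conjecture as its midpoint).
[cite: Kahn2022, Conj. 5 (arXiv p. 3); LiebSahi2021, eq. (2.1) (arXiv p. 5)]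
-/

namespace Summit.CriticalPhenomena.PercolationContinuityZ3.Theorems

open MeasureTheory Literature.Probability.LatticeModels

namespace SahiDeltaPairForm

/-! ### Ring identities in the seven moments -/

/-- **Pair form of `Δ_U`:** `Δ_U = Π_{UV} + Π_{UW} − Π_{VW}` with `Π_{VW} = m_uvw(m_vw + m_v m_w) − m_vw(m_v m_uw + m_w m_uv)`
and `Π_{UV}, Π_{UW}` by relabelling (the pair is singled out). [this work] -/
theorem deltaU_eq_pair_form {R : Type*} [CommRing R] (mU mV mW mUV mUW mVW mUVW : R) :
    mUVW * ((mUV + mU * mV) + (mUW + mU * mW) - (mVW + mV * mW))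
        + mVW * (mUV * (mW - mU) + mUW * (mV - mU)) - mUV * mUW * (mV + mW)
      = (mUVW * (mUV + mU * mV) - mUV * (mU * mVW + mV * mUW))
        + (mUVW * (mUW + mU * mW) - mUW * (mU * mVW + mW * mUV))
        - (mUVW * (mVW + mV * mW) - mVW * (mV * mUW + mW * mUV)) := by
  ring

/-- **Slot relation** `2·Π_{VW} = Δ_V + Δ_W` (hence `Π_{VW} = (Δ_V + Δ_W)/2` and `ΣΔ = ΣΠ`). [this work] -/
theorem two_piVW_eq {R : Type*} [CommRing R] (mU mV mW mUV mUW mVW mUVW : R) :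
    2 * (mUVW * (mVW + mV * mW) - mVW * (mV * mUW + mW * mUV))
      = (mUVW * ((mUV + mU * mV) + (mVW + mV * mW) - (mUW + mU * mW))
          + mUW * (mUV * (mW - mV) + mVW * (mU - mV)) - mUV * mVW * (mU + mW))
        + (mUVW * ((mUW + mU * mW) + (mVW + mV * mW) - (mUV + mU * mV))
          + mUV * (mUW * (mV - mW) + mVW * (mU - mW)) - mUW * mVW * (mU + mV)) := by
  ring

/-- **Corner `U = Ω`** (`m_u = 1`, `m_uv = m_v`, `m_uw = m_w`, `m_uvw = m_vw`):
`E₃ − Δ_U = (m_vw − m_v m_w)(1 − m_v − m_w + m_vw)` (= `Cov(V,W)·μ(Vᶜ ∩ Wᶜ)`). [this work] -/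
theorem sahiE3_sub_deltaU_univ {R : Type*} [CommRing R] (mV mW mVW : R) :
    (2 * mVW - (1 * mVW + mV * mW + mW * mV) + 1 * mV * mW)
      - (mVW * ((mV + 1 * mV) + (mW + 1 * mW) - (mVW + mV * mW))
          + mVW * (mV * (mW - 1) + mW * (mV - 1)) - mV * mW * (mV + mW))
      = (mVW - mV * mW) * (1 - mV - mW + mVW) := by
  ring

/-- **Corner `U = Ω`**, upper side: `E₃ + Δ_U = (m_vw − m_v m_w)(1 + m_v + m_w − m_vw)` (= `Cov(V,W)(1 + μ(V ∪ W))`).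
[this work] -/
theorem sahiE3_add_deltaU_univ {R : Type*} [CommRing R] (mV mW mVW : R) :
    (2 * mVW - (1 * mVW + mV * mW + mW * mV) + 1 * mV * mW)
      + (mVW * ((mV + 1 * mV) + (mW + 1 * mW) - (mVW + mV * mW))
          + mVW * (mV * (mW - 1) + mW * (mV - 1)) - mV * mW * (mV + mW))
      = (mVW - mV * mW) * (1 + mV + mW - mVW) := by
  ring

/-- **Corner `W = Ω`** (trivial third slot; `m_w = 1`, `m_uw = m_u`, `m_vw = m_v`, `m_uvw = m_uv`):
`E₃ − Δ_U = (m_uv − m_u m_v)(1 − m_u + m_v − m_uv)` (= `Cov(U,V)(μUᶜ + μ(V∖U))`) and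
`E₃ + Δ_U = (m_uv − m_u m_v)(1 + m_u − m_v + m_uv)`. [this work] -/
theorem sahiE3_sub_add_deltaU_third_univ {R : Type*} [CommRing R] (mU mV mUV : R) :
    ((2 * mUV - (mU * mV + mV * mU + 1 * mUV) + mU * mV * 1)
        - (mUV * ((mUV + mU * mV) + (mU + mU * 1) - (mV + mV * 1))
            + mV * (mUV * (1 - mU) + mU * (mV - mU)) - mUV * mU * (mV + 1))
        = (mUV - mU * mV) * (1 - mU + mV - mUV))
    ∧ ((2 * mUV - (mU * mV + mV * mU + 1 * mUV) + mU * mV * 1)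
        + (mUV * ((mUV + mU * mV) + (mU + mU * 1) - (mV + mV * 1))
            + mV * (mUV * (1 - mU) + mU * (mV - mU)) - mUV * mU * (mV + 1))
        = (mUV - mU * mV) * (1 + mU - mV + mUV)) := by
  constructor <;> ring

/-- **Corner `U ⊇ V ∪ W`** (`m_uv = m_v`, `m_uw = m_w`, `m_uvw = m_vw`):
`E₃ − Δ_U = (m_vw − m_v m_w)(2 − m_u − (m_v + m_w − m_vw))` and `E₃ + Δ_U = (m_vw − m_v m_w)(2 − m_u + (m_v + m_w − m_vw))`.
[this work] -/
theorem sahiE3_sub_add_deltaU_superset {R : Type*} [CommRing R] (mU mV mW mVW : R) :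
    ((2 * mVW - (mU * mVW + mV * mW + mW * mV) + mU * mV * mW)
        - (mVW * ((mV + mU * mV) + (mW + mU * mW) - (mVW + mV * mW))
            + mVW * (mV * (mW - mU) + mW * (mV - mU)) - mV * mW * (mV + mW))
        = (mVW - mV * mW) * (2 - mU - (mV + mW - mVW)))
    ∧ ((2 * mVW - (mU * mVW + mV * mW + mW * mV) + mU * mV * mW)
        + (mVW * ((mV + mU * mV) + (mW + mU * mW) - (mVW + mV * mW))
            + mVW * (mV * (mW - mU) + mW * (mV - mU)) - mV * mW * (mV + mW))
        = (mVW - mV * mW) * (2 - mU + (mV + mW - mVW))) := by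
  constructor <;> ring

/-- **Diagonal `U = V = W = F`** (all seven moments equal to `f`): `E₃ = f(1−f)(2−f)`, `E₃ − Δ = 2f(1−f)²`, `E₃ + Δ = 2f(1−f)`
(so R1 holds there and `E₃ − Δ` has the double root at `f = 1`). [this work] -/
theorem sahiE3_sub_add_delta_diag {R : Type*} [CommRing R] (f : R) :
    (2 * f - (f * f + f * f + f * f) + f * f * f = f * (1 - f) * (2 - f))
    ∧ ((2 * f - (f * f + f * f + f * f) + f * f * f)
        - (f * ((f + f * f) + (f + f * f) - (f + f * f)) + f * (f * (f - f) + f * (f - f)) - f * f * (f + f))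
        = 2 * f * (1 - f) ^ 2)
    ∧ ((2 * f - (f * f + f * f + f * f) + f * f * f)
        + (f * ((f + f * f) + (f + f * f) - (f + f * f)) + f * (f * (f - f) + f * (f - f)) - f * f * (f + f))
        = 2 * f * (1 - f)) := by
  refine ⟨by ring, by ring, by ring⟩

/-- **Influence form of the two-level (M⁺) endpoint of the log-derivative schema.**  With level-1 moments `x_*`, level-0 moments
`y_*` and increments `d_* = x_* − y_*` (`Inf(F) = μ(F¹) − μ(F⁰)`), the quantity `3β₂ − β₃` of `SahiE3TwoLevel.sahiE3_M_plus_form`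
equals `2E₃(x) + Σ_cyc d_u·(x_vw − x_v x_w) + Σ_cyc x_u·d_vw − 2·d_uvw`: "twice the influence on `U∩V∩W` is at most `2E₃¹` plus
`Σ Inf(U)·Cov(V¹,W¹)` plus `Σ μ(U¹)·Inf(V∩W)`". [this work] -/
theorem M_plus_influence_form {R : Type*} [CommRing R]
    (xu xv xw xuv xuw xvw xuvw yu yv yw yuv yuw yvw yuvw : R) :
    (4 * xuvw + 2 * yuvw
        - ((xu * xvw + xu * yvw + yu * xvw) + (xv * xuw + xv * yuw + yv * xuw) + (xw * xuv + xw * yuv + yw * xuv))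
        + (yu * xv * xw + xu * yv * xw + xu * xv * yw))
      - (2 * xuvw - (xu * xvw + xv * xuw + xw * xuv) + xu * xv * xw)
      = 2 * (2 * xuvw - (xu * xvw + xv * xuw + xw * xuv) + xu * xv * xw)
        + ((xu - yu) * (xvw - xv * xw) + (xv - yv) * (xuw - xu * xw) + (xw - yw) * (xuv - xu * xv))
        + (xu * (xvw - yvw) + xv * (xuw - yuw) + xw * (xuv - yuv))
        - 2 * (xuvw - yuvw) := by
  ring

/-- **Influence form of the (M⁻) endpoint:** `3β₁ − β₀ = 2E₃(y) + 2·d_uvw − Σ_cyc d_u·(y_vw − y_v y_w) − Σ_cyc y_u·d_vw`. [this work] -/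
theorem M_minus_influence_form {R : Type*} [CommRing R]
    (xu xv xw xuv xuw xvw xuvw yu yv yw yuv yuw yvw yuvw : R) :
    (4 * yuvw + 2 * xuvw
        - ((yu * yvw + yu * xvw + xu * yvw) + (yv * yuw + yv * xuw + xv * yuw) + (yw * yuv + yw * xuv + xw * yuv))
        + (xu * yv * yw + yu * xv * yw + yu * yv * xw))
      - (2 * yuvw - (yu * yvw + yv * yuw + yw * yuv) + yu * yv * yw)
      = 2 * (2 * yuvw - (yu * yvw + yv * yuw + yw * yuv) + yu * yv * yw)
        + 2 * (xuvw - yuvw)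
        - ((xu - yu) * (yvw - yv * yw) + (xv - yv) * (yuw - yu * yw) + (xw - yw) * (yuv - yu * yv))
        - (yu * (xvw - yvw) + yv * (xuw - yuw) + yw * (xuv - yuv)) := by
  ring

/-! ### Measure-level corners of R1 -/

/-- **R1 at `U = Ω`, any measure with total mass one on the events in play:** if `V, W` are positively correlated
(`μV·μW ≤ μ(V∩W)`) and `μ(V ∪ W) ≤ 1` then `|Δ_U(Ω,V,W)| ≤ E₃(Ω,V,W)`, where for `U = Ω` the moments are `m_u = 1`, `m_uv = μV`,
`m_uw = μW`, `m_uvw = μ(V∩W)`.  Both sides factor: `E₃ − Δ = Cov·μ((V∪W)ᶜ)`, `E₃ + Δ = Cov·(1 + μ(V∪W))`. [this work] -/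
theorem abs_deltaU_le_sahiE3_univ {Ω : Type*} [MeasurableSpace Ω] (μ : Measure Ω) [IsProbabilityMeasure μ]
    {V W : Set Ω} (hWm : MeasurableSet W) (hVW : μ.real V * μ.real W ≤ μ.real (V ∩ W)) :
    |μ.real (V ∩ W) * ((μ.real V + 1 * μ.real V) + (μ.real W + 1 * μ.real W) - (μ.real (V ∩ W) + μ.real V * μ.real W))
        + μ.real (V ∩ W) * (μ.real V * (μ.real W - 1) + μ.real W * (μ.real V - 1))
        - μ.real V * μ.real W * (μ.real V + μ.real W)|
      ≤ sahiE3 μ Set.univ V W := by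
  have hE : sahiE3 μ Set.univ V W
      = 2 * μ.real (V ∩ W) - (1 * μ.real (V ∩ W) + μ.real V * μ.real W + μ.real W * μ.real V)
        + 1 * μ.real V * μ.real W := by
    simp only [sahiE3_def, Set.univ_inter, probReal_univ]; ring
  have hunion : μ.real (V ∪ W) + μ.real (V ∩ W) = μ.real V + μ.real W := measureReal_union_add_inter hWm
  have hle : μ.real (V ∪ W) ≤ 1 := measureReal_le_one
  have hcov : 0 ≤ μ.real (V ∩ W) - μ.real V * μ.real W := by linarith
  rw [abs_le, hE]
  constructor
  · -- `−E₃ ≤ Δ` ⟺ `0 ≤ E₃ + Δ = Cov·(1 + μ(V∪W))`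
    have h := sahiE3_add_deltaU_univ (μ.real V) (μ.real W) (μ.real (V ∩ W))
    have hpos : 0 ≤ (μ.real (V ∩ W) - μ.real V * μ.real W) * (1 + μ.real V + μ.real W - μ.real (V ∩ W)) :=
      mul_nonneg hcov (by linarith [measureReal_nonneg (μ := μ) (s := V ∪ W)])
    linarith
  · have h := sahiE3_sub_deltaU_univ (μ.real V) (μ.real W) (μ.real (V ∩ W))
    have hpos : 0 ≤ (μ.real (V ∩ W) - μ.real V * μ.real W) * (1 - μ.real V - μ.real W + μ.real (V ∩ W)) :=
      mul_nonneg hcov (by linarith)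
    linarith

/-- **R1 when `U ⊇ V ∪ W`:** for a probability measure, `V, W ⊆ U`, `V, W` positively correlated (and `W` measurable),
`|Δ_U(U,V,W)| ≤ E₃(U,V,W)`. [this work] -/
theorem abs_deltaU_le_sahiE3_of_subset_subset {Ω : Type*} [MeasurableSpace Ω] (μ : Measure Ω) [IsProbabilityMeasure μ]
    {U V W : Set Ω} (hVU : V ⊆ U) (hWU : W ⊆ U) (hWm : MeasurableSet W)
    (hVW : μ.real V * μ.real W ≤ μ.real (V ∩ W)) :
    |μ.real (U ∩ V ∩ W) * ((μ.real (U ∩ V) + μ.real U * μ.real V) + (μ.real (U ∩ W) + μ.real U * μ.real W)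
          - (μ.real (V ∩ W) + μ.real V * μ.real W))
        + μ.real (V ∩ W) * (μ.real (U ∩ V) * (μ.real W - μ.real U) + μ.real (U ∩ W) * (μ.real V - μ.real U))
        - μ.real (U ∩ V) * μ.real (U ∩ W) * (μ.real V + μ.real W)|
      ≤ sahiE3 μ U V W := by
  have hUV : U ∩ V = V := Set.inter_eq_right.2 hVU
  have hUW : U ∩ W = W := Set.inter_eq_right.2 hWU
  have hUVW : U ∩ V ∩ W = V ∩ W := by rw [hUV]
  rw [sahiE3_def, hUVW, hUV, hUW]
  have hunion : μ.real (V ∪ W) + μ.real (V ∩ W) = μ.real V + μ.real W := measureReal_union_add_inter hWm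
  have hle : μ.real (V ∪ W) ≤ 1 := measureReal_le_one
  have hU : μ.real U ≤ 1 := measureReal_le_one
  have hcov : 0 ≤ μ.real (V ∩ W) - μ.real V * μ.real W := by linarith
  have h := sahiE3_sub_add_deltaU_superset (μ.real U) (μ.real V) (μ.real W) (μ.real (V ∩ W))
  rw [abs_le]
  constructor
  · have hpos : 0 ≤ (μ.real (V ∩ W) - μ.real V * μ.real W)
        * (2 - μ.real U + (μ.real V + μ.real W - μ.real (V ∩ W))) :=
      mul_nonneg hcov (by linarith [measureReal_nonneg (μ := μ) (s := V ∪ W)])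
    linarith [h.2]
  · have hpos : 0 ≤ (μ.real (V ∩ W) - μ.real V * μ.real W)
        * (2 - μ.real U - (μ.real V + μ.real W - μ.real (V ∩ W))) :=
      mul_nonneg hcov (by linarith)
    linarith [h.1]

variable {ι : Type*}

/-- **R1 at `U = Ω` for product measures** (`prodBernoulli p`, any index type): increasing `V, W` are positively correlated by
Harris, so `|Δ_U(Ω,V,W)| ≤ E₃(Ω,V,W)`. [this work] -/
theorem prodBernoulli_abs_deltaU_le_sahiE3_univ (p : ι → unitInterval) {V W : Set (Set ι)}
    (hV : IsUpperSet V) (hW : IsUpperSet W) (hVm : MeasurableSet V) (hWm : MeasurableSet W) :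
    |(prodBernoulli p).real (V ∩ W) * (((prodBernoulli p).real V + 1 * (prodBernoulli p).real V)
          + ((prodBernoulli p).real W + 1 * (prodBernoulli p).real W)
          - ((prodBernoulli p).real (V ∩ W) + (prodBernoulli p).real V * (prodBernoulli p).real W))
        + (prodBernoulli p).real (V ∩ W) * ((prodBernoulli p).real V * ((prodBernoulli p).real W - 1)
          + (prodBernoulli p).real W * ((prodBernoulli p).real V - 1))
        - (prodBernoulli p).real V * (prodBernoulli p).real W * ((prodBernoulli p).real V + (prodBernoulli p).real W)|
      ≤ sahiE3 (prodBernoulli p) Set.univ V W :=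
  abs_deltaU_le_sahiE3_univ _ hWm (prodBernoulli_harris p hV hW hVm hWm)

/-- **R1 for product measures when one increasing event contains the other two** (`V ∪ W ⊆ U`). [this work] -/
theorem prodBernoulli_abs_deltaU_le_sahiE3_of_union_subset (p : ι → unitInterval) {U V W : Set (Set ι)}
    (hV : IsUpperSet V) (hW : IsUpperSet W) (hVm : MeasurableSet V) (hWm : MeasurableSet W)
    (hVU : V ⊆ U) (hWU : W ⊆ U) :
    |(prodBernoulli p).real (U ∩ V ∩ W) * (((prodBernoulli p).real (U ∩ V) + (prodBernoulli p).real U * (prodBernoulli p).real V)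
          + ((prodBernoulli p).real (U ∩ W) + (prodBernoulli p).real U * (prodBernoulli p).real W)
          - ((prodBernoulli p).real (V ∩ W) + (prodBernoulli p).real V * (prodBernoulli p).real W))
        + (prodBernoulli p).real (V ∩ W) * ((prodBernoulli p).real (U ∩ V) * ((prodBernoulli p).real W - (prodBernoulli p).real U)
          + (prodBernoulli p).real (U ∩ W) * ((prodBernoulli p).real V - (prodBernoulli p).real U))
        - (prodBernoulli p).real (U ∩ V) * (prodBernoulli p).real (U ∩ W) * ((prodBernoulli p).real V + (prodBernoulli p).real W)|
      ≤ sahiE3 (prodBernoulli p) U V W :=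
  abs_deltaU_le_sahiE3_of_subset_subset _ hVU hWU hWm (prodBernoulli_harris p hV hW hVm hWm)

end SahiDeltaPairForm

end Summit.CriticalPhenomena.PercolationContinuityZ3.Theorems
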